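import Summits.QuantumFields.QCD.Theorems.QuarksAsStableActionCriticalLineDiamagnetismRectFreqOpDefs
import Mathlib.Analysis.InnerProductSpace.PiL2

/-!
# `ℓ²` lower bound for the 2D frequency operator (crux `stmt-QuantumFields-9734`, line `Sketch`, Route B, cell step B6)

Sub-problem context: `Summits/QuantumFields/QCD/Statement.lean`; crux decl
`Summit.QuantumFields.QCD.Theses.QuarksAsStableAction.CriticalLineDiamagnetism`; registered aux stub `cellNorms`, serving
`cellInvert` (and reusable by `cellFirstOrder`, `cellSecondOrder`) of the B6 cell lemma of `stub_heavyFrequencyGain`.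

We control the rectangular frequency operator `D = freqOpR g A m ω₀ ω₁` on `ℤ/L₁ × ℤ/L₂` (file `…RectFreqOpDefs`) in the
Euclidean norm of `ℓ²(sites × colour × spin)`, entirely at the level of vectors (`Σ ‖·‖²`), without operator-norm
instances:

* `freqOpR_apply_eq`, `freqOpR_mulVec_apply`: the block form `(D v)_x = (1 ⊗ N_ω) v_x − Σ_{dir} [(σU ⊗ ½(1 − g)) v_{x+e}
  + (σ'U'ᴴ ⊗ ½(1 + g)) v_{x−e}]`, `N_ω = M_ω·1 + i(sin ω₀ g₀ + sin ω₁ g₁)`, `M_ω = m + 4 − cos ω₀ − cos ω₁`;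
* `sum_norm_sq_onsite_ge`: `‖(M·1 + iT) a‖² ≥ M² ‖a‖²` for Hermitian `T` (so `‖N_ω⁻¹‖ ≤ 1/M_ω`);
* `sum_norm_sq_hop_le`: a one-direction hop `(U_x ⊗ P) v_{e x} + (V_x ⊗ Q) v_{e⁻¹ x}` with complementary orthogonal spin
  projections `P, Q` and colour parts of `ℓ²`-bound `C` has `ℓ²`-bound `C` (orthogonal ranges + Pythagoras), whence each hop
  direction of `D` has norm `≤ 1` and a perturbation of the links in one direction by `U − 1` has norm `≤ sup ‖U − 1‖`;
* `cellNorms` (registered): `(M_ω − 2) ‖v‖ ≤ ‖D v‖`, i.e. `D` is invertible with `‖D⁻¹‖ ≤ 1/(M_ω − 2)` once `M_ω > 2`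
  (the Neumann-series bound `‖N⁻¹‖/(1 − ‖N⁻¹H‖)` in lower-bound form).
-/

noncomputable section

open scoped BigOperators Matrix ComplexConjugate Kronecker
open Matrix Complex

namespace Summit.QuantumFields.QCD.Cruxes.CriticalLineDiamagnetism.ChessboardCellGain
namespace FrequencyDiamagnetism

/-! ### `Σ‖·‖²` bookkeeping on finite blocks -/

/-- `Σ ‖w k‖² = star w ⬝ᵥ w` (as a complex number). -/
theorem star_dotProduct_self_eq {κ : Type} [Fintype κ] (w : κ → ℂ) :
    star w ⬝ᵥ w = ((∑ k, ‖w k‖ ^ 2 : ℝ) : ℂ) := by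
  rw [Complex.ofReal_sum]
  simp only [dotProduct, Pi.star_apply, Complex.ofReal_pow]
  refine Finset.sum_congr rfl fun k _ => ?_
  rw [Complex.star_def, ← Complex.normSq_eq_conj_mul_self, Complex.normSq_eq_norm_sq, Complex.ofReal_pow]

/-- `Σ ‖w k‖² = Re (star w ⬝ᵥ w)`. -/
theorem sum_norm_sq_eq_re {κ : Type} [Fintype κ] (w : κ → ℂ) :
    (∑ k, ‖w k‖ ^ 2 : ℝ) = (star w ⬝ᵥ w).re := by
  rw [star_dotProduct_self_eq, Complex.ofReal_re]

/-- Adjoint: `star (B a) ⬝ᵥ (C b) = star a ⬝ᵥ ((Bᴴ C) b)`. -/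
theorem star_mulVec_dotProduct_mulVec {κ κ' : Type} [Fintype κ] [Fintype κ'] (B C : Matrix κ' κ ℂ) (a b : κ → ℂ) :
    star (B *ᵥ a) ⬝ᵥ (C *ᵥ b) = star a ⬝ᵥ ((Bᴴ * C) *ᵥ b) := by
  rw [star_mulVec, dotProduct_mulVec, vecMul_vecMul, ← dotProduct_mulVec]

/-- Expansion `Σ‖a + b‖² = Σ‖a‖² + Σ‖b‖² + 2 Re (star a ⬝ᵥ b)`. -/
theorem sum_norm_sq_add {κ : Type} [Fintype κ] (a b : κ → ℂ) :
    (∑ k, ‖(a + b) k‖ ^ 2 : ℝ) = (∑ k, ‖a k‖ ^ 2 : ℝ) + (∑ k, ‖b k‖ ^ 2 : ℝ) + 2 * (star a ⬝ᵥ b).re := by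
  rw [sum_norm_sq_eq_re, sum_norm_sq_eq_re, sum_norm_sq_eq_re, star_add, add_dotProduct, dotProduct_add,
    dotProduct_add, star_dotProduct b a]
  simp only [Complex.add_re, Complex.star_def, Complex.conj_re]
  ring

/-- A matrix with `Wᴴ W = 1` preserves `Σ‖·‖²`. -/
theorem sum_norm_sq_mulVec_of_isometry {κ κ' : Type} [Fintype κ] [Fintype κ'] [DecidableEq κ] (W : Matrix κ' κ ℂ)
    (hW : Wᴴ * W = 1) (w : κ → ℂ) : (∑ k, ‖(W *ᵥ w) k‖ ^ 2 : ℝ) = ∑ k, ‖w k‖ ^ 2 := by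
  rw [sum_norm_sq_eq_re, sum_norm_sq_eq_re, star_mulVec_dotProduct_mulVec, hW, one_mulVec]

/-- Colour action on colour–spin blocks: `((U ⊗ 1) w) (c, i) = (U (w(·, i))) c`. -/
theorem kronecker_one_mulVec_apply {α β : Type} [Fintype α] [Fintype β] [DecidableEq β] (U : Matrix α α ℂ)
    (w : α × β → ℂ) (k : α × β) :
    ((U ⊗ₖ (1 : Matrix β β ℂ)) *ᵥ w) k = (U *ᵥ fun d => w (d, k.2)) k.1 := by
  simp only [mulVec, dotProduct, Fintype.sum_prod_type, kroneckerMap_apply, Matrix.one_apply, mul_ite, mul_one,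
    mul_zero, ite_mul, zero_mul, Finset.sum_ite_eq, Finset.mem_univ, if_true]

/-- The colour action `U ⊗ 1` inherits the bound `Σ‖U w‖² ≤ C Σ‖w‖²`. -/
theorem sum_norm_sq_kronecker_one_le {α β : Type} [Fintype α] [Fintype β] [DecidableEq β] (U : Matrix α α ℂ) (C : ℝ)
    (hU : ∀ w : α → ℂ, (∑ c, ‖(U *ᵥ w) c‖ ^ 2 : ℝ) ≤ C * ∑ c, ‖w c‖ ^ 2) (w : α × β → ℂ) :
    (∑ k, ‖((U ⊗ₖ (1 : Matrix β β ℂ)) *ᵥ w) k‖ ^ 2 : ℝ) ≤ C * ∑ k, ‖w k‖ ^ 2 := by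
  calc (∑ k, ‖((U ⊗ₖ (1 : Matrix β β ℂ)) *ᵥ w) k‖ ^ 2 : ℝ) = ∑ i : β, ∑ c : α, ‖(U *ᵥ fun d => w (d, i)) c‖ ^ 2 := by
        simp only [kronecker_one_mulVec_apply]
        rw [Fintype.sum_prod_type_right]
    _ ≤ ∑ i : β, C * ∑ d : α, ‖w (d, i)‖ ^ 2 := Finset.sum_le_sum fun i _ => hU _
    _ = C * ∑ k, ‖w k‖ ^ 2 := by rw [Fintype.sum_prod_type_right, Finset.mul_sum]

/-- Complementary orthogonal spin projections split `Σ‖·‖²`: `Σ‖(1 ⊗ P) a‖² + Σ‖(1 ⊗ Q) a‖² = Σ‖a‖²`. -/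
theorem sum_norm_sq_proj_split {α β : Type} [Fintype α] [Fintype β] [DecidableEq α] [DecidableEq β]
    (P Q : Matrix β β ℂ) (hP : Pᴴ = P) (hQ : Qᴴ = Q) (hPP : P * P = P) (hQQ : Q * Q = Q) (hPQ1 : P + Q = 1)
    (a : α × β → ℂ) :
    (∑ k, ‖(((1 : Matrix α α ℂ) ⊗ₖ P) *ᵥ a) k‖ ^ 2 : ℝ) + ∑ k, ‖(((1 : Matrix α α ℂ) ⊗ₖ Q) *ᵥ a) k‖ ^ 2 =
      ∑ k, ‖a k‖ ^ 2 := by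
  rw [sum_norm_sq_eq_re, sum_norm_sq_eq_re, sum_norm_sq_eq_re, star_mulVec_dotProduct_mulVec,
    star_mulVec_dotProduct_mulVec, conjTranspose_kronecker, conjTranspose_kronecker, conjTranspose_one, hP, hQ,
    ← mul_kronecker_mul, ← mul_kronecker_mul, Matrix.mul_one, hPP, hQQ, ← Complex.add_re, ← dotProduct_add,
    ← add_mulVec, ← kronecker_add, hPQ1, one_kronecker_one, one_mulVec]

/-- Orthogonality of the two hop ranges: `Re (star ((U ⊗ P) a) ⬝ᵥ ((V ⊗ Q) b)) = 0` when `Pᴴ Q = 0`. -/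
theorem re_cross_eq_zero {α β : Type} [Fintype α] [Fintype β] (U V : Matrix α α ℂ) (P Q : Matrix β β ℂ)
    (hPQ : Pᴴ * Q = 0) (a b : α × β → ℂ) :
    (star ((U ⊗ₖ P) *ᵥ a) ⬝ᵥ ((V ⊗ₖ Q) *ᵥ b)).re = 0 := by
  rw [star_mulVec_dotProduct_mulVec, conjTranspose_kronecker, ← mul_kronecker_mul, hPQ, kronecker_zero,
    zero_mulVec, dotProduct_zero, Complex.zero_re]

/-- The on-site lower bound: for Hermitian `T`, `M² Σ‖a‖² ≤ Σ‖(M·1 + i T) a‖²`. -/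
theorem sum_norm_sq_onsite_ge {κ : Type} [Fintype κ] [DecidableEq κ] (T : Matrix κ κ ℂ) (hT : Tᴴ = T) (M : ℝ)
    (a : κ → ℂ) :
    M ^ 2 * (∑ k, ‖a k‖ ^ 2 : ℝ) ≤ ∑ k, ‖(((M : ℂ) • (1 : Matrix κ κ ℂ) + Complex.I • T) *ᵥ a) k‖ ^ 2 := by
  have hreal : (star a ⬝ᵥ (T *ᵥ a)).im = 0 := by
    have h : star (star a ⬝ᵥ (T *ᵥ a)) = star a ⬝ᵥ (T *ᵥ a) := by
      rw [← star_dotProduct_star, star_star, star_mulVec, hT, dotProduct_mulVec]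
    rw [Complex.star_def] at h
    have := congrArg Complex.im h
    rw [Complex.conj_im] at this
    linarith
  rw [add_mulVec, smul_mulVec, smul_mulVec, one_mulVec, sum_norm_sq_add]
  have h1 : (∑ k, ‖((M : ℂ) • a) k‖ ^ 2 : ℝ) = M ^ 2 * ∑ k, ‖a k‖ ^ 2 := by
    rw [Finset.mul_sum]
    refine Finset.sum_congr rfl fun k _ => ?_
    rw [Pi.smul_apply, smul_eq_mul, norm_mul, Complex.norm_real, mul_pow, Real.norm_eq_abs, sq_abs]
  have h2 : (star ((M : ℂ) • a) ⬝ᵥ (Complex.I • (T *ᵥ a))).re = 0 := by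
    rw [star_smul, smul_dotProduct, dotProduct_smul, Complex.star_def, Complex.conj_ofReal, smul_eq_mul,
      smul_eq_mul]
    simp only [Complex.mul_re, Complex.ofReal_re, Complex.ofReal_im, Complex.I_re, Complex.I_im, hreal, zero_mul,
      sub_zero, mul_zero]
  rw [h1, h2, mul_zero, add_zero]
  have h3 : (0 : ℝ) ≤ ∑ k, ‖(Complex.I • (T *ᵥ a)) k‖ ^ 2 := Finset.sum_nonneg fun k _ => sq_nonneg _
  linarith

/-- **The hop bound.**  A one-direction hop operator `v ↦ (x ↦ (U_x ⊗ P) v_{e x} + (V_x ⊗ Q) v_{e⁻¹ x})` with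
complementary orthogonal spin projections `P`, `Q` and colour parts satisfying `Σ‖U_x w‖² ≤ C Σ‖w‖²`, `Σ‖V_x w‖² ≤ C Σ‖w‖²`
satisfies `Σ‖hop v‖² ≤ C Σ‖v‖²` (orthogonality of the two ranges, then Pythagoras `‖(1⊗P)a‖² + ‖(1⊗Q)a‖² = ‖a‖²` after
re-indexing the two shifted sums). -/
theorem sum_norm_sq_hop_le {S α β : Type} [Fintype S] [Fintype α] [Fintype β] [DecidableEq α] [DecidableEq β]
    (e : Equiv.Perm S) (U V : S → Matrix α α ℂ) (P Q : Matrix β β ℂ) (hP : Pᴴ = P) (hQ : Qᴴ = Q) (hPP : P * P = P)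
    (hQQ : Q * Q = Q) (hPQ : P * Q = 0) (hPQ1 : P + Q = 1) (C : ℝ)
    (hU : ∀ x (w : α → ℂ), (∑ c, ‖(U x *ᵥ w) c‖ ^ 2 : ℝ) ≤ C * ∑ c, ‖w c‖ ^ 2)
    (hV : ∀ x (w : α → ℂ), (∑ c, ‖(V x *ᵥ w) c‖ ^ 2 : ℝ) ≤ C * ∑ c, ‖w c‖ ^ 2) (v : S × α × β → ℂ) :
    (∑ x, ∑ k, ‖(((U x ⊗ₖ P) *ᵥ fun k => v (e x, k)) + ((V x ⊗ₖ Q) *ᵥ fun k => v (e.symm x, k))) k‖ ^ 2 : ℝ) ≤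
      C * ∑ p, ‖v p‖ ^ 2 := by
  have key : ∀ x, (∑ k, ‖(((U x ⊗ₖ P) *ᵥ fun k => v (e x, k)) + ((V x ⊗ₖ Q) *ᵥ fun k => v (e.symm x, k))) k‖ ^ 2 : ℝ) ≤
      C * ∑ k, ‖(((1 : Matrix α α ℂ) ⊗ₖ P) *ᵥ fun k => v (e x, k)) k‖ ^ 2 +
        C * ∑ k, ‖(((1 : Matrix α α ℂ) ⊗ₖ Q) *ᵥ fun k => v (e.symm x, k)) k‖ ^ 2 := by
    intro x
    rw [sum_norm_sq_add, re_cross_eq_zero _ _ _ _ (by rw [hP, hPQ]), mul_zero, add_zero]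
    have hUP : U x ⊗ₖ P = (U x ⊗ₖ (1 : Matrix β β ℂ)) * ((1 : Matrix α α ℂ) ⊗ₖ P) := by
      rw [← mul_kronecker_mul, Matrix.mul_one, Matrix.one_mul]
    have hVQ : V x ⊗ₖ Q = (V x ⊗ₖ (1 : Matrix β β ℂ)) * ((1 : Matrix α α ℂ) ⊗ₖ Q) := by
      rw [← mul_kronecker_mul, Matrix.mul_one, Matrix.one_mul]
    rw [hUP, hVQ, ← mulVec_mulVec, ← mulVec_mulVec]
    exact add_le_add (sum_norm_sq_kronecker_one_le _ C (hU x) _) (sum_norm_sq_kronecker_one_le _ C (hV x) _)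
  calc (∑ x, ∑ k, ‖(((U x ⊗ₖ P) *ᵥ fun k => v (e x, k)) + ((V x ⊗ₖ Q) *ᵥ fun k => v (e.symm x, k))) k‖ ^ 2 : ℝ)
      ≤ ∑ x, (C * ∑ k, ‖(((1 : Matrix α α ℂ) ⊗ₖ P) *ᵥ fun k => v (e x, k)) k‖ ^ 2 +
          C * ∑ k, ‖(((1 : Matrix α α ℂ) ⊗ₖ Q) *ᵥ fun k => v (e.symm x, k)) k‖ ^ 2) := Finset.sum_le_sum fun x _ => key x
    _ = C * (∑ y, ((∑ k, ‖(((1 : Matrix α α ℂ) ⊗ₖ P) *ᵥ fun k => v (y, k)) k‖ ^ 2 : ℝ) +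
          ∑ k, ‖(((1 : Matrix α α ℂ) ⊗ₖ Q) *ᵥ fun k => v (y, k)) k‖ ^ 2)) := by
        rw [Finset.sum_add_distrib, ← Finset.mul_sum, ← Finset.mul_sum,
          Equiv.sum_comp e (fun y => (∑ k, ‖(((1 : Matrix α α ℂ) ⊗ₖ P) *ᵥ fun k => v (y, k)) k‖ ^ 2 : ℝ)),
          Equiv.sum_comp e.symm (fun y => (∑ k, ‖(((1 : Matrix α α ℂ) ⊗ₖ Q) *ᵥ fun k => v (y, k)) k‖ ^ 2 : ℝ)),
          ← mul_add, ← Finset.sum_add_distrib]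
    _ = C * ∑ p, ‖v p‖ ^ 2 := by
        rw [Fintype.sum_prod_type]
        congr 1
        exact Finset.sum_congr rfl fun y _ => sum_norm_sq_proj_split P Q hP hQ hPP hQQ hPQ1 _

/-! ### The frequency operator in block form -/

/-- Combining the five pieces of an entry of `freqOpR`. -/
theorem entry_combine {a b c d e a' b' c' d' e' : ℂ} (ha : a = a') (hb : (1 / 2 : ℂ) * b = b')
    (hc : (1 / 2 : ℂ) * c = c') (hd : (1 / 2 : ℂ) * d = d') (he : (1 / 2 : ℂ) * e = e') :
    a - (1 / 2 : ℂ) * (b + c + d + e) = a' - (b' + c') - (d' + e') := by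
  subst ha hb hc hd he; ring

/-- Backward hop condition along the first coordinate, solved for the column site. -/
theorem eq_shift_fst_iff {L₁ L₂ : ℕ} (x y : ZMod L₁ × ZMod L₂) : x = (y.1 + 1, y.2) ↔ y = (x.1 - 1, x.2) := by
  obtain ⟨x₁, x₂⟩ := x
  obtain ⟨y₁, y₂⟩ := y
  simp only [Prod.mk.injEq]
  constructor
  · rintro ⟨rfl, rfl⟩; simp
  · rintro ⟨rfl, rfl⟩; simp

/-- Backward hop condition along the second coordinate, solved for the column site. -/
theorem eq_shift_snd_iff {L₁ L₂ : ℕ} (x y : ZMod L₁ × ZMod L₂) : x = (y.1, y.2 + 1) ↔ y = (x.1, x.2 - 1) := by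
  obtain ⟨x₁, x₂⟩ := x
  obtain ⟨y₁, y₂⟩ := y
  simp only [Prod.mk.injEq]
  constructor
  · rintro ⟨rfl, rfl⟩; simp
  · rintro ⟨rfl, rfl⟩; simp

/-- **Block form of the entries of `freqOpR`**: on-site block `1 ⊗ N_ω`, `N_ω = M_ω·1 + i(sin ω₀ g₀ + sin ω₁ g₁)`, and, per
lattice direction, the forward hop `σ U ⊗ ½(1 − g)` to the site `x + e` and the backward hop `σ' U'ᴴ ⊗ ½(1 + g)` to `x − e`. -/
theorem freqOpR_apply_eq {L₁ L₂ : ℕ} (g : Fin 4 → Matrix (Fin 4) (Fin 4) ℂ)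
    (A : ZMod L₁ → ZMod L₂ → Fin 4 → Matrix.unitaryGroup (Fin 3) ℂ) (m ω₀ ω₁ : ℝ)
    (x y : ZMod L₁ × ZMod L₂) (k k' : Fin 3 × Fin 4) :
    freqOpR g A m ω₀ ω₁ (x, k) (y, k') =
      (if x = y then ((1 : Matrix (Fin 3) (Fin 3) ℂ) ⊗ₖ
          (((m + 4 - Real.cos ω₀ - Real.cos ω₁ : ℝ) : ℂ) • (1 : Matrix (Fin 4) (Fin 4) ℂ) +
            Complex.I • (((Real.sin ω₀ : ℝ) : ℂ) • g 0 + ((Real.sin ω₁ : ℝ) : ℂ) • g 1))) k k' else 0) -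
      ((if y = (x.1 + 1, x.2) then (((if x.1 = -1 then (-1 : ℂ) else 1) • (A x.1 x.2 2 : Matrix (Fin 3) (Fin 3) ℂ)) ⊗ₖ
          ((1 / 2 : ℂ) • (1 - g 2))) k k' else 0) +
        (if y = (x.1 - 1, x.2) then (((if x.1 - 1 = -1 then (-1 : ℂ) else 1) •
          star (A (x.1 - 1) x.2 2 : Matrix (Fin 3) (Fin 3) ℂ)) ⊗ₖ ((1 / 2 : ℂ) • (1 + g 2))) k k' else 0)) -
      ((if y = (x.1, x.2 + 1) then (((if x.2 = -1 then (-1 : ℂ) else 1) • (A x.1 x.2 3 : Matrix (Fin 3) (Fin 3) ℂ)) ⊗ₖ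
          ((1 / 2 : ℂ) • (1 - g 3))) k k' else 0) +
        (if y = (x.1, x.2 - 1) then (((if x.2 - 1 = -1 then (-1 : ℂ) else 1) •
          star (A x.1 (x.2 - 1) 3 : Matrix (Fin 3) (Fin 3) ℂ)) ⊗ₖ ((1 / 2 : ℂ) • (1 + g 3))) k k' else 0)) := by
  simp only [freqOpR, Matrix.of_apply, eq_shift_fst_iff x y, eq_shift_snd_iff x y]
  refine entry_combine ?_ ?_ ?_ ?_ ?_
  · by_cases hxy : x = y
    · simp only [hxy, true_and, if_true, kroneckerMap_apply, Matrix.one_apply, Matrix.add_apply, Matrix.smul_apply,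
        smul_eq_mul]
      split_ifs <;> ring
    · simp only [hxy, false_and, if_false]
  · split_ifs <;> simp only [kroneckerMap_apply, Matrix.smul_apply, smul_eq_mul, mul_zero] <;> ring
  · by_cases h : y = (x.1 - 1, x.2)
    · subst h
      simp only [if_true, kroneckerMap_apply, Matrix.smul_apply, smul_eq_mul]
      split_ifs <;> ring
    · simp only [h, if_false, mul_zero]
  · split_ifs <;> simp only [kroneckerMap_apply, Matrix.smul_apply, smul_eq_mul, mul_zero] <;> ring
  · by_cases h : y = (x.1, x.2 - 1)
    · subst h
      simp only [if_true, kroneckerMap_apply, Matrix.smul_apply, smul_eq_mul]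
      split_ifs <;> ring
    · simp only [h, if_false, mul_zero]

/-- **Block form of `freqOpR` acting on a vector**: `(D v)_x = (1 ⊗ N_ω) v_x − Σ_dir [(σU ⊗ P₋) v_{x+e} + (σ'U'ᴴ ⊗ P₊) v_{x−e}]`. -/
theorem freqOpR_mulVec_apply {L₁ L₂ : ℕ} [NeZero L₁] [NeZero L₂] (g : Fin 4 → Matrix (Fin 4) (Fin 4) ℂ)
    (A : ZMod L₁ → ZMod L₂ → Fin 4 → Matrix.unitaryGroup (Fin 3) ℂ) (m ω₀ ω₁ : ℝ)
    (v : (ZMod L₁ × ZMod L₂) × Fin 3 × Fin 4 → ℂ) (x : ZMod L₁ × ZMod L₂) (k : Fin 3 × Fin 4) :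
    (freqOpR g A m ω₀ ω₁ *ᵥ v) (x, k) =
      (((1 : Matrix (Fin 3) (Fin 3) ℂ) ⊗ₖ
          (((m + 4 - Real.cos ω₀ - Real.cos ω₁ : ℝ) : ℂ) • (1 : Matrix (Fin 4) (Fin 4) ℂ) +
            Complex.I • (((Real.sin ω₀ : ℝ) : ℂ) • g 0 + ((Real.sin ω₁ : ℝ) : ℂ) • g 1))) *ᵥ fun k => v (x, k)) k -
      (((((if x.1 = -1 then (-1 : ℂ) else 1) • (A x.1 x.2 2 : Matrix (Fin 3) (Fin 3) ℂ)) ⊗ₖ ((1 / 2 : ℂ) • (1 - g 2))) *ᵥ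
            fun k => v ((x.1 + 1, x.2), k)) +
          ((((if x.1 - 1 = -1 then (-1 : ℂ) else 1) • star (A (x.1 - 1) x.2 2 : Matrix (Fin 3) (Fin 3) ℂ)) ⊗ₖ
            ((1 / 2 : ℂ) • (1 + g 2))) *ᵥ fun k => v ((x.1 - 1, x.2), k)) : Fin 3 × Fin 4 → ℂ) k -
      (((((if x.2 = -1 then (-1 : ℂ) else 1) • (A x.1 x.2 3 : Matrix (Fin 3) (Fin 3) ℂ)) ⊗ₖ ((1 / 2 : ℂ) • (1 - g 3))) *ᵥ
            fun k => v ((x.1, x.2 + 1), k)) +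
          ((((if x.2 - 1 = -1 then (-1 : ℂ) else 1) • star (A x.1 (x.2 - 1) 3 : Matrix (Fin 3) (Fin 3) ℂ)) ⊗ₖ
            ((1 / 2 : ℂ) • (1 + g 3))) *ᵥ fun k => v ((x.1, x.2 - 1), k)) : Fin 3 × Fin 4 → ℂ) k := by
  have hsplit : (freqOpR g A m ω₀ ω₁ *ᵥ v) (x, k) = ∑ y, ∑ k', freqOpR g A m ω₀ ω₁ (x, k) (y, k') * v (y, k') := by
    simp only [mulVec, dotProduct]
    exact Fintype.sum_prod_type _
  rw [hsplit]
  simp only [freqOpR_apply_eq, sub_mul, add_mul, ite_mul, zero_mul, Finset.sum_sub_distrib, Finset.sum_add_distrib,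
    Finset.sum_ite_irrel, Finset.sum_const_zero, Finset.sum_ite_eq, Finset.sum_ite_eq', Finset.mem_univ, if_true,
    mulVec, dotProduct, Pi.add_apply]

/-! ### Spin projections, signed unitary links, and the lower bound -/

/-- For `γᴴ = γ`, `γ² = 1`, the matrices `P = ½(1 − γ)`, `Q = ½(1 + γ)` are complementary orthogonal projections. -/
theorem half_one_sub_add_proj {β : Type} [Fintype β] [DecidableEq β] (γ : Matrix β β ℂ) (hγ : γᴴ = γ) (hγ2 : γ * γ = 1) :
    ((1 / 2 : ℂ) • (1 - γ))ᴴ = (1 / 2 : ℂ) • (1 - γ) ∧ ((1 / 2 : ℂ) • (1 + γ))ᴴ = (1 / 2 : ℂ) • (1 + γ) ∧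
    (1 / 2 : ℂ) • (1 - γ) * ((1 / 2 : ℂ) • (1 - γ)) = (1 / 2 : ℂ) • (1 - γ) ∧
    (1 / 2 : ℂ) • (1 + γ) * ((1 / 2 : ℂ) • (1 + γ)) = (1 / 2 : ℂ) • (1 + γ) ∧
    (1 / 2 : ℂ) • (1 - γ) * ((1 / 2 : ℂ) • (1 + γ)) = 0 ∧ (1 / 2 : ℂ) • (1 - γ) + (1 / 2 : ℂ) • (1 + γ) = 1 := by
  have hstar : star (1 / 2 : ℂ) = 1 / 2 := by simp
  refine ⟨?_, ?_, ?_, ?_, ?_, ?_⟩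
  · rw [conjTranspose_smul, conjTranspose_sub, conjTranspose_one, hγ, hstar]
  · rw [conjTranspose_smul, conjTranspose_add, conjTranspose_one, hγ, hstar]
  · rw [Matrix.smul_mul, Matrix.mul_smul, smul_smul]
    simp only [Matrix.sub_mul, Matrix.mul_sub, Matrix.one_mul, Matrix.mul_one, hγ2]
    ext i j
    simp only [Matrix.smul_apply, Matrix.sub_apply, smul_eq_mul]
    ring
  · rw [Matrix.smul_mul, Matrix.mul_smul, smul_smul]
    simp only [Matrix.add_mul, Matrix.mul_add, Matrix.one_mul, Matrix.mul_one, hγ2]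
    ext i j
    simp only [Matrix.smul_apply, Matrix.add_apply, smul_eq_mul]
    ring
  · rw [Matrix.smul_mul, Matrix.mul_smul, smul_smul]
    simp only [Matrix.sub_mul, Matrix.mul_add, Matrix.one_mul, Matrix.mul_one, hγ2]
    ext i j
    simp only [Matrix.smul_apply, Matrix.add_apply, Matrix.sub_apply, smul_eq_mul, Matrix.zero_apply]
    ring
  · rw [← smul_add]
    ext i j
    simp only [Matrix.smul_apply, Matrix.add_apply, Matrix.sub_apply, smul_eq_mul, Matrix.one_apply]
    split_ifs <;> ring

/-- `‖a‖ − ‖b‖ − ‖c‖ ≤ ‖a − b − c‖`. -/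
theorem norm_sub_norm_sub_norm_le {E : Type} [SeminormedAddCommGroup E] (a b c : E) : ‖a‖ - ‖b‖ - ‖c‖ ≤ ‖a - b - c‖ :=
  le_trans (sub_le_sub_right (norm_sub_norm_le a b) _) (norm_sub_norm_le _ _)

/-- A seam-signed isometry `±W`, `Wᴴ W = 1`, preserves `Σ‖·‖²` (stated as the bound with constant `1`). -/
theorem sum_norm_sq_sign_smul_mulVec_le {κ : Type} [Fintype κ] [DecidableEq κ] (t : Prop) [Decidable t]
    (W : Matrix κ κ ℂ) (hW : Wᴴ * W = 1) (w : κ → ℂ) :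
    (∑ c, ‖(((if t then (-1 : ℂ) else 1) • W) *ᵥ w) c‖ ^ 2 : ℝ) ≤ 1 * ∑ c, ‖w c‖ ^ 2 := by
  have h : ((if t then (-1 : ℂ) else 1) • W)ᴴ * ((if t then (-1 : ℂ) else 1) • W) = 1 := by
    split_ifs <;> simp [hW]
  rw [one_mul, sum_norm_sq_mulVec_of_isometry _ h w]

end FrequencyDiamagnetism

open FrequencyDiamagnetism in
/-- **Aux stub `cellNorms`** (Neumann-series control of the 2D frequency operator, lower-bound form): for spin matrices
`g μ` that are Hermitian involutions, every field `A` of unitary links, every mass `m` and frequencies `ω₀, ω₁`,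
`(M_ω − 2)·‖v‖ ≤ ‖freqOpR g A m ω₀ ω₁ v‖` in `ℓ²`, `M_ω = m + 4 − cos ω₀ − cos ω₁`: the on-site block `M_ω + i(sin ω₀ g₀ + sin ω₁ g₁)`
is bounded below by `M_ω` and each of the two hop directions has norm `≤ 1`.  Hence `freqOpR` is invertible with
`‖freqOpR⁻¹‖ ≤ 1/(M_ω − 2)` as soon as `M_ω > 2`. -/
theorem cellNorms : ∀ (L₁ L₂ : ℕ) [NeZero L₁] [NeZero L₂] (g : Fin 4 → Matrix (Fin 4) (Fin 4) ℂ), (∀ μ, (g μ)ᴴ = g μ) → (∀ μ, g μ * g μ = 1) → ∀ (A : ZMod L₁ → ZMod L₂ → Fin 4 → Matrix.unitaryGroup (Fin 3) ℂ) (m ω₀ ω₁ : ℝ) (v : (ZMod L₁ × ZMod L₂) × Fin 3 × Fin 4 → ℂ), (m + 4 - Real.cos ω₀ - Real.cos ω₁ - 2) * ‖(WithLp.toLp 2 v : EuclideanSpace ℂ ((ZMod L₁ × ZMod L₂) × Fin 3 × Fin 4))‖ ≤ ‖(WithLp.toLp 2 (Matrix.mulVec (FrequencyDiamagnetism.freqOpR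 g A m ω₀ ω₁) v) : EuclideanSpace ℂ ((ZMod L₁ × ZMod L₂) × Fin 3 × Fin 4))‖ := by
  intro L₁ L₂ _ _ g hg hg2 A m ω₀ ω₁ v
  obtain ⟨hP₂, hQ₂, hPP₂, hQQ₂, hPQ₂, hPQ1₂⟩ := half_one_sub_add_proj (g 2) (hg 2) (hg2 2)
  obtain ⟨hP₃, hQ₃, hPP₃, hQQ₃, hPQ₃, hPQ1₃⟩ := half_one_sub_add_proj (g 3) (hg 3) (hg2 3)
  -- the three global pieces of `D v`
  have hdecomp : freqOpR g A m ω₀ ω₁ *ᵥ v =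
      (fun p : (ZMod L₁ × ZMod L₂) × Fin 3 × Fin 4 => (((1 : Matrix (Fin 3) (Fin 3) ℂ) ⊗ₖ
          (((m + 4 - Real.cos ω₀ - Real.cos ω₁ : ℝ) : ℂ) • (1 : Matrix (Fin 4) (Fin 4) ℂ) +
            Complex.I • (((Real.sin ω₀ : ℝ) : ℂ) • g 0 + ((Real.sin ω₁ : ℝ) : ℂ) • g 1))) *ᵥ fun k => v (p.1, k)) p.2) -
      (fun p => (((((if p.1.1 = -1 then (-1 : ℂ) else 1) • (A p.1.1 p.1.2 2 : Matrix (Fin 3) (Fin 3) ℂ)) ⊗ₖ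
            ((1 / 2 : ℂ) • (1 - g 2))) *ᵥ fun k => v ((p.1.1 + 1, p.1.2), k)) +
          ((((if p.1.1 - 1 = -1 then (-1 : ℂ) else 1) • star (A (p.1.1 - 1) p.1.2 2 : Matrix (Fin 3) (Fin 3) ℂ)) ⊗ₖ
            ((1 / 2 : ℂ) • (1 + g 2))) *ᵥ fun k => v ((p.1.1 - 1, p.1.2), k)) : Fin 3 × Fin 4 → ℂ) p.2) -
      (fun p => (((((if p.1.2 = -1 then (-1 : ℂ) else 1) • (A p.1.1 p.1.2 3 : Matrix (Fin 3) (Fin 3) ℂ)) ⊗ₖ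
            ((1 / 2 : ℂ) • (1 - g 3))) *ᵥ fun k => v ((p.1.1, p.1.2 + 1), k)) +
          ((((if p.1.2 - 1 = -1 then (-1 : ℂ) else 1) • star (A p.1.1 (p.1.2 - 1) 3 : Matrix (Fin 3) (Fin 3) ℂ)) ⊗ₖ
            ((1 / 2 : ℂ) • (1 + g 3))) *ᵥ fun k => v ((p.1.1, p.1.2 - 1), k)) : Fin 3 × Fin 4 → ℂ) p.2) := by
    funext ⟨x, k⟩
    rw [freqOpR_mulVec_apply]
    rfl
  -- on-site lower bound
  have hN : (m + 4 - Real.cos ω₀ - Real.cos ω₁) ^ 2 *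
      ‖(WithLp.toLp 2 v : EuclideanSpace ℂ ((ZMod L₁ × ZMod L₂) × Fin 3 × Fin 4))‖ ^ 2 ≤
      ‖(WithLp.toLp 2 (fun p : (ZMod L₁ × ZMod L₂) × Fin 3 × Fin 4 => (((1 : Matrix (Fin 3) (Fin 3) ℂ) ⊗ₖ
          (((m + 4 - Real.cos ω₀ - Real.cos ω₁ : ℝ) : ℂ) • (1 : Matrix (Fin 4) (Fin 4) ℂ) +
            Complex.I • (((Real.sin ω₀ : ℝ) : ℂ) • g 0 + ((Real.sin ω₁ : ℝ) : ℂ) • g 1))) *ᵥ fun k => v (p.1, k)) p.2) :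
          EuclideanSpace ℂ ((ZMod L₁ × ZMod L₂) × Fin 3 × Fin 4))‖ ^ 2 := by
    rw [EuclideanSpace.norm_sq_eq, EuclideanSpace.norm_sq_eq]
    dsimp only
    rw [Fintype.sum_prod_type (α₁ := ZMod L₁ × ZMod L₂) (α₂ := Fin 3 × Fin 4),
      Fintype.sum_prod_type (α₁ := ZMod L₁ × ZMod L₂) (α₂ := Fin 3 × Fin 4), Finset.mul_sum]
    refine Finset.sum_le_sum fun x _ => ?_
    rw [kronecker_add, kronecker_smul, kronecker_smul, one_kronecker_one]
    refine sum_norm_sq_onsite_ge _ ?_ _ _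
    rw [conjTranspose_kronecker, conjTranspose_one, conjTranspose_add, conjTranspose_smul, conjTranspose_smul, hg, hg,
      Complex.star_def, Complex.conj_ofReal, Complex.conj_ofReal]
  -- the shift permutations
  let e₁ : Equiv.Perm (ZMod L₁ × ZMod L₂) := ⟨fun x => (x.1 + 1, x.2), fun x => (x.1 - 1, x.2), fun x => by simp,
    fun x => by simp⟩
  let e₂ : Equiv.Perm (ZMod L₁ × ZMod L₂) := ⟨fun x => (x.1, x.2 + 1), fun x => (x.1, x.2 - 1), fun x => by simp,
    fun x => by simp⟩
  have hlink : ∀ (a : ZMod L₁) (b : ZMod L₂) (μ : Fin 4), (A a b μ : Matrix (Fin 3) (Fin 3) ℂ)ᴴ * (A a b μ : Matrix _ _ ℂ) = 1 :=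
    fun a b μ => Matrix.UnitaryGroup.star_mul_self _
  have hlink' : ∀ (a : ZMod L₁) (b : ZMod L₂) (μ : Fin 4),
      (star (A a b μ : Matrix (Fin 3) (Fin 3) ℂ))ᴴ * star (A a b μ : Matrix (Fin 3) (Fin 3) ℂ) = 1 := by
    intro a b μ
    rw [Matrix.star_eq_conjTranspose, conjTranspose_conjTranspose]
    exact Unitary.coe_mul_star_self _
  have hH2 : ‖(WithLp.toLp 2 (fun p : (ZMod L₁ × ZMod L₂) × Fin 3 × Fin 4 =>
      (((((if p.1.1 = -1 then (-1 : ℂ) else 1) • (A p.1.1 p.1.2 2 : Matrix (Fin 3) (Fin 3) ℂ)) ⊗ₖ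
            ((1 / 2 : ℂ) • (1 - g 2))) *ᵥ fun k => v ((p.1.1 + 1, p.1.2), k)) +
          ((((if p.1.1 - 1 = -1 then (-1 : ℂ) else 1) • star (A (p.1.1 - 1) p.1.2 2 : Matrix (Fin 3) (Fin 3) ℂ)) ⊗ₖ
            ((1 / 2 : ℂ) • (1 + g 2))) *ᵥ fun k => v ((p.1.1 - 1, p.1.2), k)) : Fin 3 × Fin 4 → ℂ) p.2) :
          EuclideanSpace ℂ ((ZMod L₁ × ZMod L₂) × Fin 3 × Fin 4))‖ ^ 2 ≤
      1 * ‖(WithLp.toLp 2 v : EuclideanSpace ℂ ((ZMod L₁ × ZMod L₂) × Fin 3 × Fin 4))‖ ^ 2 := by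
    rw [EuclideanSpace.norm_sq_eq, EuclideanSpace.norm_sq_eq]
    dsimp only
    rw [Fintype.sum_prod_type (α₁ := ZMod L₁ × ZMod L₂) (α₂ := Fin 3 × Fin 4)]
    have h := sum_norm_sq_hop_le e₁ (fun x => (if x.1 = -1 then (-1 : ℂ) else 1) • (A x.1 x.2 2 : Matrix (Fin 3) (Fin 3) ℂ))
      (fun x => (if x.1 - 1 = -1 then (-1 : ℂ) else 1) • star (A (x.1 - 1) x.2 2 : Matrix (Fin 3) (Fin 3) ℂ))
      _ _ hP₂ hQ₂ hPP₂ hQQ₂ hPQ₂ hPQ1₂ 1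
      (fun x w => sum_norm_sq_sign_smul_mulVec_le _ _ (hlink _ _ _) w)
      (fun x w => sum_norm_sq_sign_smul_mulVec_le _ _ (hlink' _ _ _) w) v
    exact h
  have hH3 : ‖(WithLp.toLp 2 (fun p : (ZMod L₁ × ZMod L₂) × Fin 3 × Fin 4 =>
      (((((if p.1.2 = -1 then (-1 : ℂ) else 1) • (A p.1.1 p.1.2 3 : Matrix (Fin 3) (Fin 3) ℂ)) ⊗ₖ
            ((1 / 2 : ℂ) • (1 - g 3))) *ᵥ fun k => v ((p.1.1, p.1.2 + 1), k)) +
          ((((if p.1.2 - 1 = -1 then (-1 : ℂ) else 1) • star (A p.1.1 (p.1.2 - 1) 3 : Matrix (Fin 3) (Fin 3) ℂ)) ⊗ₖ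
            ((1 / 2 : ℂ) • (1 + g 3))) *ᵥ fun k => v ((p.1.1, p.1.2 - 1), k)) : Fin 3 × Fin 4 → ℂ) p.2) :
          EuclideanSpace ℂ ((ZMod L₁ × ZMod L₂) × Fin 3 × Fin 4))‖ ^ 2 ≤
      1 * ‖(WithLp.toLp 2 v : EuclideanSpace ℂ ((ZMod L₁ × ZMod L₂) × Fin 3 × Fin 4))‖ ^ 2 := by
    rw [EuclideanSpace.norm_sq_eq, EuclideanSpace.norm_sq_eq]
    dsimp only
    rw [Fintype.sum_prod_type (α₁ := ZMod L₁ × ZMod L₂) (α₂ := Fin 3 × Fin 4)]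
    have h := sum_norm_sq_hop_le e₂ (fun x => (if x.2 = -1 then (-1 : ℂ) else 1) • (A x.1 x.2 3 : Matrix (Fin 3) (Fin 3) ℂ))
      (fun x => (if x.2 - 1 = -1 then (-1 : ℂ) else 1) • star (A x.1 (x.2 - 1) 3 : Matrix (Fin 3) (Fin 3) ℂ))
      _ _ hP₃ hQ₃ hPP₃ hQQ₃ hPQ₃ hPQ1₃ 1
      (fun x w => sum_norm_sq_sign_smul_mulVec_le _ _ (hlink _ _ _) w)
      (fun x w => sum_norm_sq_sign_smul_mulVec_le _ _ (hlink' _ _ _) w) v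
    exact h
  rw [hdecomp, WithLp.toLp_sub, WithLp.toLp_sub]
  refine le_trans ?_ (norm_sub_norm_sub_norm_le _ _ _)
  have h2 := le_of_sq_le_sq ((mul_pow _ _ 2).trans_le hN) (norm_nonneg _)
  rw [one_mul] at hH2 hH3
  have h3 := le_of_sq_le_sq hH2 (norm_nonneg _)
  have h4 := le_of_sq_le_sq hH3 (norm_nonneg _)
  linarith

end Summit.QuantumFields.QCD.Cruxes.CriticalLineDiamagnetism.ChessboardCellGain

end
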